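import Summits.Ventures.PercRepro.RLSRuleKFourSupply

/-!
# C-025 at q = 3: the triangle plane — family and counting (night-3, gen 4)

The triangle on `6` points (catalogue #13): three `3`-point lines pairwise meeting in a point, the three meeting
points distinct — three points (the vertices) on two lines each, three (the mid-points) on one.  Simplicity and «no
`4`-point line» come from the core.

* `Triangle` — the shape as a predicate on the line set `L` (three dependent triples, degrees `2, 2, 2, 1, 1, 1`);
* `depTriples_eq_of_triangle`; `lines_subset_four_triangle` (a `4`-subset contains at most one line),
  `card_lined_four_triangle` (`9` lined `4`-subsets); `card_lines_in_erase` (a `5`-subset `G ∖ {v}` contains exactly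
  `3 − deg v` lines), `powersetCard_five_eq_image` / `sum_powersetCard_five` (the `5`-subsets are the `G ∖ {v}`);
  `triangle_family` — ranks, disjointness, cards (`17`, `15`, `6`).
Imports `RLSRuleKFourSupply`.  Axioms: standard.
-/

open scoped Matroid

namespace PercRepro

namespace NightThree

open Finset ThmH PerFlat

variable {α : Type*} [DecidableEq α] {M : Matroid α} [M.Finite]

open scoped Classical in
/-- **The triangle plane**: `|G| = 6`, `L` a set of three `3`-point lines of `G` (rank `2`), every point of `G` on one
or two of them, exactly three points on two, and every `3`-subset of `G` outside `L` independent. -/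
def Triangle (M : Matroid α) (G : Finset α) (L : Finset (Finset α)) : Prop :=
  G.card = 6 ∧ L.card = 3 ∧ (∀ ℓ ∈ L, ℓ ⊆ G ∧ ℓ.card = 3 ∧ M.eRk (ℓ : Set α) = 2) ∧
    (∀ v ∈ G, (L.filter (fun ℓ => v ∈ ℓ)).card = 1 ∨ (L.filter (fun ℓ => v ∈ ℓ)).card = 2) ∧
    (G.filter (fun v => (L.filter (fun ℓ => v ∈ ℓ)).card = 2)).card = 3 ∧
    (∀ T ∈ G.powersetCard 3, T ∉ L → M.Indep (T : Set α))

open scoped Classical in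
omit [M.Finite] in
/-- The dependent triples of a triangle plane are its three lines. -/
theorem depTriples_eq_of_triangle {G : Finset α} {L : Finset (Finset α)} (h : Triangle M G L) :
    depTriples M G = L := by
  obtain ⟨hGc, hLc, hL, hdeg, hdeg2, hind⟩ := h
  ext T
  unfold depTriples
  rw [Finset.mem_filter, Finset.mem_powersetCard]
  constructor
  · rintro ⟨⟨hTG, hTc⟩, hdep⟩
    by_contra hT
    exact hdep (hind T (Finset.mem_powersetCard.2 ⟨hTG, hTc⟩) hT)
  · intro hT
    obtain ⟨hTG, hTc, hTr⟩ := hL T hT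
    exact ⟨⟨hTG, hTc⟩, not_indep_of_eRk_two_card_three hTr hTc⟩

open scoped Classical in
/-- Two distinct lines of a triangle plane of the core meet in at most one point: a `4`-subset contains at most one. -/
theorem lines_subset_four_triangle {p : ℕ} (hc : Core M p) {G : Finset α} {L : Finset (Finset α)}
    (hG : G ∈ flatsQ M 3) (h : Triangle M G L) {B : Finset α} (_hB : B ⊆ G) (hBc : B.card = 4) :
    (L.filter (fun ℓ => ℓ ⊆ B)).card ≤ 1 := by
  obtain ⟨hGc, hLc, hL, hdeg, hdeg2, hind⟩ := h
  have hGE : G ⊆ gr M := (mem_flatsQ.1 hG).1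
  rw [Finset.card_le_one]
  intro ℓ hℓ ℓ' hℓ'
  rw [Finset.mem_filter] at hℓ hℓ'
  by_contra hne
  obtain ⟨hℓG, hℓc, hℓr⟩ := hL ℓ hℓ.1
  obtain ⟨hℓ'G, hℓ'c, hℓ'r⟩ := hL ℓ' hℓ'.1
  have hmeet := card_inter_le_one_of_lines (simpleOn_of_core hc hGE) (not_hasLongLine_of_core hc hGE) hGE hℓG hℓ'G
    hℓc hℓ'c hℓr hℓ'r hne
  have hu := Finset.card_union_add_card_inter ℓ ℓ'
  have := Finset.card_le_card (Finset.union_subset hℓ.2 hℓ'.2)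
  omega

open scoped Classical in
omit [M.Finite] in
/-- The lines inside `G ∖ {v}` are the lines avoiding `v`: `#{ℓ ⊆ G ∖ {v}} + deg v = #L`. -/
theorem card_lines_in_erase {G : Finset α} {L : Finset (Finset α)} (hL : ∀ ℓ ∈ L, ℓ ⊆ G) {v : α} :
    (L.filter (fun ℓ => ℓ ⊆ G.erase v)).card + (L.filter (fun ℓ => v ∈ ℓ)).card = L.card := by
  have hfilt : L.filter (fun ℓ => ℓ ⊆ G.erase v) = L.filter (fun ℓ => ¬ v ∈ ℓ) := by
    ext ℓ
    simp only [Finset.mem_filter]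
    constructor
    · rintro ⟨hℓ, hℓB⟩; exact ⟨hℓ, fun hv => (Finset.mem_erase.1 (hℓB hv)).1 rfl⟩
    · rintro ⟨hℓ, hvℓ⟩
      refine ⟨hℓ, fun x hx => Finset.mem_erase.2 ⟨fun hxv => hvℓ (hxv ▸ hx), hL ℓ hℓ hx⟩⟩
  rw [hfilt, add_comm]
  exact Finset.card_filter_add_card_filter_not (s := L) (fun ℓ => v ∈ ℓ)

omit [M.Finite] in
/-- The `5`-subsets of a `6`-set are the `G ∖ {v}`. -/
theorem powersetCard_five_eq_image {G : Finset α} (hGc : G.card = 6) :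
    G.powersetCard 5 = G.image (fun v => G.erase v) := by
  ext B
  rw [Finset.mem_powersetCard, Finset.mem_image]
  constructor
  · rintro ⟨hBG, hBc⟩
    obtain ⟨v, hv⟩ : ∃ v, G \ B = {v} := by
      apply Finset.card_eq_one.1
      rw [Finset.card_sdiff_of_subset hBG, hGc, hBc]
    have hvG : v ∈ G := (Finset.mem_sdiff.1 (by rw [hv]; exact Finset.mem_singleton_self v)).1
    refine ⟨v, hvG, ?_⟩
    rw [Finset.erase_eq, ← hv, Finset.sdiff_sdiff_eq_self hBG]
  · rintro ⟨v, hvG, rfl⟩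
    exact ⟨Finset.erase_subset v G, by rw [Finset.card_erase_of_mem hvG, hGc]⟩

omit [M.Finite] in
/-- Sums over the `5`-subsets of a `6`-set are sums over the removed point. -/
theorem sum_powersetCard_five {G : Finset α} (hGc : G.card = 6) (F : Finset α → ℚ) :
    ∑ B ∈ G.powersetCard 5, F B = ∑ v ∈ G, F (G.erase v) := by
  rw [powersetCard_five_eq_image hGc, Finset.sum_image]
  intro x hx y hy hxy
  exact Finset.erase_injOn G hx hy hxy

open scoped Classical in
/-- The family of rank-`3` subsets of a triangle plane of the core: ranks, disjointness, cards (`17`, `15`, `6`). -/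
theorem triangle_family {p : ℕ} (hc : Core M p) {G : Finset α} {L : Finset (Finset α)} (hG : G ∈ flatsQ M 3)
    (h : Triangle M G L) :
    (∀ B ∈ (G.powersetCard 3).filter (fun T => T ∉ L), B ⊆ G ∧ B.card = 3 ∧ (∀ ℓ ∈ L, ¬ ℓ ⊆ B) ∧ M.Indep (B : Set α)) ∧
    (∀ B ∈ (G.powersetCard 3).filter (fun T => T ∉ L) ∪ G.powersetCard 4 ∪ G.powersetCard 5 ∪ {G},
      B ⊆ G ∧ M.eRk (B : Set α) = 3) ∧
    Disjoint ((G.powersetCard 3).filter (fun T => T ∉ L)) (G.powersetCard 4) ∧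
    Disjoint ((G.powersetCard 3).filter (fun T => T ∉ L) ∪ G.powersetCard 4) (G.powersetCard 5) ∧
    Disjoint ((G.powersetCard 3).filter (fun T => T ∉ L) ∪ G.powersetCard 4 ∪ G.powersetCard 5) {G} ∧
    ((G.powersetCard 3).filter (fun T => T ∉ L)).card = 17 ∧ (G.powersetCard 4).card = 15 ∧
    (G.powersetCard 5).card = 6 := by
  obtain ⟨hGc, hLc, hL, hdeg, hdeg2, hind⟩ := h
  have hG3 : M.eRk (G : Set α) = 3 := eRk_eq_three_of_mem_flatsQ' hG
  have hmem3 : ∀ B ∈ (G.powersetCard 3).filter (fun T => T ∉ L),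
      B ⊆ G ∧ B.card = 3 ∧ (∀ ℓ ∈ L, ¬ ℓ ⊆ B) ∧ M.Indep (B : Set α) := by
    intro B hB
    rw [Finset.mem_filter, Finset.mem_powersetCard] at hB
    obtain ⟨⟨hBG, hBc⟩, hBL⟩ := hB
    refine ⟨hBG, hBc, ?_, hind B (Finset.mem_powersetCard.2 ⟨hBG, hBc⟩) hBL⟩
    intro ℓ hℓ hl
    have := (hL ℓ hℓ).2.1
    exact hBL ((Finset.eq_of_subset_of_card_le hl (by omega)).symm ▸ hℓ)
  have hc4 : ∀ B ∈ G.powersetCard 4, B.card = 4 := fun B hB => (Finset.mem_powersetCard.1 hB).2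
  have hc5 : ∀ B ∈ G.powersetCard 5, B.card = 5 := fun B hB => (Finset.mem_powersetCard.1 hB).2
  refine ⟨hmem3, ?_, ?_, ?_, ?_, ?_, ?_, ?_⟩
  · intro B hB
    simp only [Finset.mem_union, Finset.mem_singleton] at hB
    rcases hB with ((hB | hB) | hB) | hBG'
    · obtain ⟨hBG, hBc, _, hBind⟩ := hmem3 B hB
      exact ⟨hBG, eRk_eq_three_of_indep_card hBind hBc⟩
    · obtain ⟨hBG, hBc⟩ := Finset.mem_powersetCard.1 hB
      exact ⟨hBG, eRk_eq_three_of_four_le_of_core hc hG hBG (by omega)⟩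
    · obtain ⟨hBG, hBc⟩ := Finset.mem_powersetCard.1 hB
      exact ⟨hBG, eRk_eq_three_of_four_le_of_core hc hG hBG (by omega)⟩
    · rw [hBG']; exact ⟨le_rfl, hG3⟩
  · rw [Finset.disjoint_left]; intro B h3 h4; have := (hmem3 B h3).2.1; have := hc4 B h4; omega
  · rw [Finset.disjoint_left]; intro B hB h5; have := hc5 B h5
    rcases Finset.mem_union.1 hB with h3 | h4
    · have := (hmem3 B h3).2.1; omega
    · have := hc4 B h4; omega
  · rw [Finset.disjoint_right]; intro B hB; rw [Finset.mem_singleton] at hB; rw [hB]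
    simp only [Finset.mem_union, not_or]
    refine ⟨⟨?_, ?_⟩, ?_⟩
    · intro h3; have := (hmem3 G h3).2.1; omega
    · intro h4; have := hc4 G h4; omega
    · intro h5; have := hc5 G h5; omega
  · -- `20 − 3`: the lines are `3`-subsets of `G`
    have hsub : L ⊆ G.powersetCard 3 := fun ℓ hℓ => Finset.mem_powersetCard.2 ⟨(hL ℓ hℓ).1, (hL ℓ hℓ).2.1⟩
    have := Finset.card_filter_add_card_filter_not (s := G.powersetCard 3) (fun T => T ∉ L)
    have hL' : (G.powersetCard 3).filter (fun T => ¬ T ∉ L) = L := by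
      ext T; simp only [Finset.mem_filter, not_not]
      exact ⟨fun h => h.2, fun h => ⟨hsub h, h⟩⟩
    rw [hL', hLc, Finset.card_powersetCard, hGc, show Nat.choose 6 3 = 20 by norm_num [Nat.choose]] at this
    omega
  · rw [Finset.card_powersetCard, hGc]; rfl
  · rw [Finset.card_powersetCard, hGc]; rfl

open scoped Classical in
/-- The `4`-subsets of a triangle plane of the core: `9` through a line (one line each), `6` through none. -/
theorem card_lined_four_triangle {p : ℕ} (hc : Core M p) {G : Finset α} {L : Finset (Finset α)}
    (hG : G ∈ flatsQ M 3) (h : Triangle M G L) :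
    ((G.powersetCard 4).filter (fun B => ∃ ℓ ∈ L, ℓ ⊆ B)).card = 9 := by
  obtain ⟨hGc, hLc, hL, hdeg, hdeg2, hind⟩ := h
  have h' : Triangle M G L := ⟨hGc, hLc, hL, hdeg, hdeg2, hind⟩
  have hbi : (G.powersetCard 4).filter (fun B => ∃ ℓ ∈ L, ℓ ⊆ B) =
      L.biUnion (fun ℓ => (G.powersetCard 4).filter (fun B => ℓ ⊆ B)) := by
    ext B
    simp only [Finset.mem_filter, Finset.mem_biUnion]
    constructor
    · rintro ⟨hB, ℓ, hℓ, hl⟩; exact ⟨ℓ, hℓ, hB, hl⟩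
    · rintro ⟨ℓ, hℓ, hB, hl⟩; exact ⟨hB, ℓ, hℓ, hl⟩
  rw [hbi, Finset.card_biUnion]
  · rw [Finset.sum_congr rfl (fun ℓ hℓ => card_filter_four_line_six (hL ℓ hℓ).1 (hL ℓ hℓ).2.1 hGc),
      Finset.sum_const, hLc, smul_eq_mul]
  · intro ℓ hℓ ℓ' hℓ' hne
    show Disjoint _ _
    rw [Finset.disjoint_left]
    intro B h1 h2
    rw [Finset.mem_filter] at h1 h2
    have hcard := lines_subset_four_triangle hc hG h' (Finset.mem_powersetCard.1 h1.1).1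
      (Finset.mem_powersetCard.1 h1.1).2
    rw [Finset.card_le_one] at hcard
    exact hne (hcard ℓ (Finset.mem_filter.2 ⟨hℓ, h1.2⟩) ℓ' (Finset.mem_filter.2 ⟨hℓ', h2.2⟩))

end NightThree

end PercRepro
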